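import Summits.Ventures.LatticeQCDFlow.Scaling.PerAttemptHubLaws
import Summits.Ventures.LatticeQCDFlow.Scaling.TaggedPerAttemptCertificateEveryEdgeAll
import Summits.Ventures.LatticeQCDFlow.Scaling.TaggedDeficitStarCoverEveryEdge
import Summits.Ventures.LatticeQCDFlow.Scaling.AdjacentPerStepBracket
import Summits.Ventures.LatticeQCDFlow.Scaling.TaggedPerStepGain
import Summits.Ventures.LatticeQCDFlow.Scaling.PerAttemptMeanCondition
import Summits.Ventures.LatticeQCDFlow.Scaling.PerEdgeCertificate
import Summits.Ventures.LatticeQCDFlow.Scaling.TaggedDomination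

/-!
HONEST FRAMING: exact (Metropolis-corrected) sampling algorithms for lattice gauge theory; figures
of merit are autocorrelation/cost numbers at stated couplings and volumes; no continuum-physics
claim.

# AdjacentPerAttemptMeanCondition — THE PER-EDGE MEAN CONDITION OF THE CLOCK-CONDITIONED STEP LAW FOR AN ORIENTED ADJACENT EQUAL-HUB PAIR OF THE LUMPED STAR:
# `Σ_{j<n}σʲ(1−σ)·V_j ≤ (1 − r̃)·Φ` FOR EVERY `n`, `r̃(c+2K+2) ≤ 2σpE_{μ0}[Wθ]`, `c ≥ 2K+4`, `K ≥ 2` — FROM CONJECTURE W′ (AC3), THE DISCOUNTED WEAK Σ (AC13), PER-STEP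
# DOMINATION (Z4) AND RESOLVENT DOMINATION (W26), NOTHING ELSE (lean-2 GEN-44, ours)

Venture-side (OURS).  Cell `lqcd-flow` (pub-lqcd), unit `pub-lqcd-lean-2-g44`, 2026-08-31.  Chapter AD (the instantiation of the C2 ∕ C4 assembly, memo MEMO-gen43 §3 (e)–(g)), file 2 =
the one-pair computation, the per-attempt analogue of chapter W file 22 (`adjacent_hpers_of_domination`).  SETTING (hypothesis-equations of W14∕W26∕Z4∕AC3 verbatim): ordinary
composition `N_C` (`Σ N_C = K`), the adjacent pair `N_X = N_C + δ_a`, `N_Y = N_C + δ_b` (`a ≠ b`, `W_b ≤ W_a`), a common present hub `z`; the tagged chains `P_X, P_Y` on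
`Option S`, their `j`-attempt laws `x_j, y_j` from `z`, the tail resolvents `x̃, ỹ` (from `z`) and `x̃_★, ỹ_★` (from ★) at odds `σ`; the content hub chains `K_X = Kh(N_X)`, `K_Y = Kh(N_Y)`
and their `j`-attempt laws `w^X_j, w^Y_j` from `z` (forward recursion); the pair potential `Φ = c − 2(1−σ)θ_z + Σθ(N_X+N_Y)` and insertion term `e = 2(1−σ)θ_z + 2σθ̄` of chapter W.
THE PER-ATTEMPT VALUE of the pair is `V_j = Σ_{α,β} q_j(α,β)·Δ(N_X−δ_α, N_Y−δ_β)·(Φ + e − θ_α − θ_β)` with `q_j` the LPW-4.7 optimal coupling of `(w^X_j, w^Y_j)` — by W file 2's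
`lumpedAny_mulVec_potential` this is the one-step image of the product potential under the `j`-attempt cycle kernel (file 3 of this chapter makes that identification).

THE CHAIN OF THE PROOF.  AC15 lumps `w^X_j = cont_*x_j`; Z4 gives domination off the start content, so AC10's bracket applies (with its free content `:= a` when `z = b`); Z8's
penalty identity and the lumping turn its right side into `Φ + (e−2) + c^X_j + c^Y_j − (Φ+e−2)g_j + (Φ+e−1)ε_j` (`g_j = x_j(★) + x_j(a) − y_j(a)`, `ε_j = (y_j(z) − x_j(z))⁺`, the
growth term at `z = a` is `(y_j(a) − x_j(a) − x_j(★))⁺ ≤ ε_j`, at `z = b` it vanishes); AC9 on the tagged chains (resolvent `(1−σ)δ_z + σx̃`, file 1) bounds the truncated discounted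
sums of costs and gains, and `Σ_{j<n}σʲ(1−σ)ε_j = σ·D_{n−1}` is AC3∕AC13's deficit; AC17 turns W′ (`J = n−1`), the weak Σ (`κ = K/(K²−1)`, `3κ ≤ 2` for `K ≥ 2`, `m = 2`,
`c ≥ 2K+4`), W26's `ỹ(a) ≤ x̃(a)` and `r̃Φ ≤ r̃(c+2K+2) ≤ 2σpE_{μ0}[Wθ] = 2σ(1−θ̄)` into AC16's certificate; AC16 concludes.

* **`adjacent_perAttempt_meanCondition`**: `Σ_{j<n}σʲ(1−σ)(1 − (1 − V_j/Φ)) ≤ 1 − r̃` for every `n`.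

File 3 feeds this, per oriented adjacent edge (the other orientation by transposition, file 1), into AC6 `clock_mixingTime_le_edgeRates`.  Literature grade (cell rule): OWN,
plumbing on typed files; nothing cited; no new bib keys.
-/

open Finset
open Literature.Probability.MarkovChains

namespace Summit.Ventures.LatticeQCDFlow.Scaling

section PerAttemptMean
variable {S : Type*} [Fintype S] [DecidableEq S]
variable {W θ μ0 : S → ℝ} {acc : S → S → ℝ} {p σ c : ℝ} {K : ℕ} {NC NX NY : S → ℕ} {a b z : S}
variable {PX PY : Option S → Option S → ℝ} {KX KY : S → S → ℝ} {x y : ℕ → Option S → ℝ} {xt yt xs ys : Option S → ℝ} {wX wY : ℕ → S → ℝ}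
variable {Δ : (S → ℕ) → (S → ℕ) → ℕ}

/-- **THE PER-EDGE MEAN CONDITION OF AN ORIENTED ADJACENT EQUAL-HUB PAIR** (see the module docstring). [ours] -/
theorem adjacent_perAttempt_meanCondition (hΔ : ∀ N N', Δ N N' = ∑ v, (N v - N' v))
    (hW : ∀ v, 0 < W v) (hp0 : 0 ≤ p) (hp : ∀ v, p * W v ≤ 1) (hθ : ∀ v, θ v = 1 / (1 + p * W v))
    (hacc : ∀ h v, acc h v = min 1 (W h / W v)) (hK : 2 ≤ K) (hNC : ∑ v, NC v = K) (hab : a ≠ b) (hWab : W b ≤ W a)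
    (hX : NX = NC + Pi.single a 1) (hY : NY = NC + Pi.single b 1) (hz : NC z ≠ 0)
    (hPXoff : ∀ h v, h ≠ v → PX (some h) (some v) = if NC h = 0 then 0 else (NC v : ℝ) / K * acc h v)
    (hPXin : ∀ h, PX (some h) none = if NC h = 0 then 0 else acc h a / K)
    (hPXdiag : ∀ h, PX (some h) (some h) = 1 - (∑ v ∈ univ.erase h, PX (some h) (some v) + PX (some h) none))
    (hPXout : ∀ v, PX none (some v) = (NC v : ℝ) / K * acc a v) (hPXstay : PX none none = 1 - ∑ v, PX none (some v))
    (hPYoff : ∀ h v, h ≠ v → PY (some h) (some v) = if NC h = 0 then 0 else (NC v : ℝ) / K * acc h v)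
    (hPYin : ∀ h, PY (some h) none = if NC h = 0 then 0 else acc h b / K)
    (hPYdiag : ∀ h, PY (some h) (some h) = 1 - (∑ v ∈ univ.erase h, PY (some h) (some v) + PY (some h) none))
    (hPYout : ∀ v, PY none (some v) = (NC v : ℝ) / K * acc b v) (hPYstay : PY none none = 1 - ∑ v, PY none (some v))
    (hKXoff : ∀ h v, h ≠ v → KX h v = if NX h = 0 then 0 else (NX v : ℝ) / K * acc h v) (hKXdiag : ∀ h, KX h h = 1 - ∑ v ∈ univ.erase h, KX h v)
    (hKYoff : ∀ h v, h ≠ v → KY h v = if NY h = 0 then 0 else (NY v : ℝ) / K * acc h v) (hKYdiag : ∀ h, KY h h = 1 - ∑ v ∈ univ.erase h, KY h v)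
    (hσ0 : 0 ≤ σ) (hσ1 : σ < 1)
    (hx0 : ∀ v, x 0 v = if v = some z then 1 else 0) (hxs : ∀ n v, x (n + 1) v = ∑ h, x n h * PX h v)
    (hy0 : ∀ v, y 0 v = if v = some z then 1 else 0) (hys : ∀ n v, y (n + 1) v = ∑ h, y n h * PY h v)
    (hxt : ∀ t, xt t = (1 - σ) * PX (some z) t + σ * ∑ t', xt t' * PX t' t) (hyt : ∀ t, yt t = (1 - σ) * PY (some z) t + σ * ∑ t', yt t' * PY t' t)
    (hxsr : ∀ t, xs t = (1 - σ) * PX none t + σ * ∑ t', xs t' * PX t' t) (hysr : ∀ t, ys t = (1 - σ) * PY none t + σ * ∑ t', ys t' * PY t' t)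
    (hwX0 : ∀ v, wX 0 v = if v = z then 1 else 0) (hwXs : ∀ n v, wX (n + 1) v = ∑ h, wX n h * KX h v)
    (hwY0 : ∀ v, wY 0 v = if v = z then 1 else 0) (hwYs : ∀ n v, wY (n + 1) v = ∑ h, wY n h * KY h v)
    {Φ : ℝ} (hΦ : Φ = c + (-(1 - σ) * θ z) + (-(1 - σ) * θ z) + ∑ v, θ v * ((NX v : ℝ) + (NY v : ℝ))) (hc : 2 * (K : ℝ) + 4 ≤ c)
    (hμ0 : ∀ v, 0 ≤ μ0 v) (hμ1 : ∑ v, μ0 v = 1) {rt : ℝ} (hrt0 : 0 ≤ rt) (hrt : rt * (c + 2 * K + 2) ≤ 2 * σ * (p * ∑ v, μ0 v * (W v * θ v))) (n : ℕ) :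
    ∑ j ∈ range n, σ ^ j * (1 - σ) * (1 - (1 - (∑ α, ∑ β, optimalCoupling (wX j) (wY j) α β
        * ((Δ (NX - Pi.single α 1) (NY - Pi.single β 1) : ℝ) * (Φ + (2 * (1 - σ) * θ z + 2 * σ * ∑ v, μ0 v * θ v) - θ α - θ β))) / Φ)) ≤ 1 - rt := by
  classical
  have hK1 : 1 ≤ K := le_trans (by norm_num) hK
  have hK2 : (2 : ℝ) ≤ K := by exact_mod_cast hK
  have hθm := theta_mem hW hp0 hp hθ
  -- abbreviations
  obtain ⟨e, he⟩ : ∃ e : ℝ, e = 2 * (1 - σ) * θ z + 2 * σ * ∑ v, μ0 v * θ v := ⟨_, rfl⟩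
  rw [← he]
  -- the tagged chains and their `j`-attempt laws
  have hPX0 := tagged_nonneg hW hacc hPXoff hPXin hPXdiag hPXout hPXstay hK1 hNC
  have hPX1 := tagged_rowsum (P := PX) hPXdiag hPXstay
  have hPY0 := tagged_nonneg hW hacc hPYoff hPYin hPYdiag hPYout hPYstay hK1 hNC
  have hPY1 := tagged_rowsum (P := PY) hPYdiag hPYstay
  have hxlaw := pointLaw_nonneg_sum hPX0 hPX1 hx0 hxs
  have hylaw := pointLaw_nonneg_sum hPY0 hPY1 hy0 hys
  -- the content chains and their `j`-attempt laws; lumping (AC15)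
  have hsumX : ∑ v, NX v = K + 1 := by
    rw [hX]; simp only [Pi.add_apply]; rw [sum_add_distrib, hNC, Finset.sum_pi_single']; simp
  have hsumY : ∑ v, NY v = K + 1 := by
    rw [hY]; simp only [Pi.add_apply]; rw [sum_add_distrib, hNC, Finset.sum_pi_single']; simp
  have hwXlaw := pointLaw_nonneg_sum (starHub_nonneg hW hacc hKXoff hKXdiag hK1 hsumX) (starHub_rowsum hKXdiag) hwX0 hwXs
  have hwYlaw := pointLaw_nonneg_sum (starHub_nonneg hW hacc hKYoff hKYdiag hK1 hsumY) (starHub_rowsum hKYdiag) hwY0 hwYs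
  have hlX : ∀ j w, wX j w = x j (some w) + (if w = a then x j none else 0) :=
    lump_step hX hPXoff hPXin hPXdiag hPXout hPXstay hKXoff hKXdiag hz hx0 hxs hwX0 hwXs
  have hlY : ∀ j w, wY j w = y j (some w) + (if w = b then y j none else 0) :=
    lump_step hY hPYoff hPYin hPYdiag hPYout hPYstay hKYoff hKYdiag hz hy0 hys hwY0 hwYs
  have habsX : ∀ w, NC w = 0 → ∀ j, x j (some w) = 0 := fun w hw => tagged_law_absent hPXoff hPXout hz hx0 hxs hw
  have habsY : ∀ w, NC w = 0 → ∀ j, y j (some w) = 0 := fun w hw => tagged_law_absent hPYoff hPYout hz hy0 hys hw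
  have hlegX : ∀ j w, wX j w ≠ 0 → NX w ≠ 0 := by
    intro j w hw
    by_cases hwa : w = a
    · rw [hwa, hX]; simp
    · rw [hlX, if_neg hwa, add_zero] at hw
      have hNCw : NC w ≠ 0 := fun h0 => hw (habsX w h0 j)
      rw [hX]; simpa [hwa] using hNCw
  have hlegY : ∀ j w, wY j w ≠ 0 → NY w ≠ 0 := by
    intro j w hw
    by_cases hwb : w = b
    · rw [hwb, hY]; simp
    · rw [hlY, if_neg hwb, add_zero] at hw
      have hNCw : NC w ≠ 0 := fun h0 => hw (habsY w h0 j)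
      rw [hY]; simpa [hwb] using hNCw
  -- per-step domination off the start content (Z4), in lumped form
  have hdomZ : ∀ j w, w ≠ z → y j (some w) ≤ x j (some w) := by
    intro j w hwz
    by_cases hNw : NC w = 0
    · rw [habsX w hNw j, habsY w hNw j]
    · exact tagged_perStep_domination hW hacc hK1 hNC hWab hPXoff hPXin hPXdiag hPXout hPXstay hPYoff hPYin hPYdiag hPYout hPYstay hz hx0 hxs hy0 hys j hwz hNw
  -- the pieces of the per-attempt value
  obtain ⟨V, hV⟩ : ∃ V : ℕ → ℝ, ∀ j, V j = ∑ α, ∑ β, optimalCoupling (wX j) (wY j) α β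
      * ((Δ (NX - Pi.single α 1) (NY - Pi.single β 1) : ℝ) * (Φ + e - θ α - θ β)) := ⟨_, fun _ => rfl⟩
  obtain ⟨cx, hcx⟩ : ∃ cx : ℕ → ℝ, ∀ j, cx j = ∑ w, wX j w * (1 - θ w) := ⟨_, fun _ => rfl⟩
  obtain ⟨cy, hcy⟩ : ∃ cy : ℕ → ℝ, ∀ j, cy j = ∑ w, wY j w * (1 - θ w) := ⟨_, fun _ => rfl⟩
  obtain ⟨g, hg⟩ : ∃ g : ℕ → ℝ, ∀ j, g j = x j none + (x j (some a) - y j (some a)) := ⟨_, fun _ => rfl⟩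
  obtain ⟨ε, hε⟩ : ∃ ε : ℕ → ℝ, ∀ j, ε j = max (y j (some z) - x j (some z)) 0 := ⟨_, fun _ => rfl⟩
  have hε0 : ∀ j, 0 ≤ ε j := fun j => by rw [hε]; exact le_max_right _ _
  simp_rw [← hV]
  -- bounds on `Φ`, `e`
  have hθbar0 : 0 ≤ ∑ v, μ0 v * θ v := sum_nonneg fun v _ => mul_nonneg (hμ0 v) (by linarith [(hθm v).1])
  have hθbar1 : ∑ v, μ0 v * θ v ≤ 1 := by
    calc ∑ v, μ0 v * θ v ≤ ∑ v, μ0 v := sum_le_sum fun v _ => mul_le_of_le_one_right (hμ0 v) (hθm v).2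
      _ = 1 := hμ1
  have hMX := theta_mass_le hW hp0 hp hθ NX
  have hMY := theta_mass_le hW hp0 hp hθ NY
  have hsumXr : ∑ v, (NX v : ℝ) = K + 1 := by exact_mod_cast hsumX
  have hsumYr : ∑ v, (NY v : ℝ) = K + 1 := by exact_mod_cast hsumY
  have hsplit : ∑ v, θ v * ((NX v : ℝ) + (NY v : ℝ)) = ∑ v, θ v * (NX v : ℝ) + ∑ v, θ v * (NY v : ℝ) := by
    rw [← sum_add_distrib]; exact sum_congr rfl fun v _ => by ring
  have hMXeq : ∑ v, θ v * (NX v : ℝ) = ∑ v, θ v * (NC v : ℝ) + θ a := by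
    rw [hX]; simp only [Pi.add_apply, Nat.cast_add, mul_add, sum_add_distrib]
    congr 1
    rw [show (∑ v, θ v * ((Pi.single a (1 : ℕ) : S → ℕ) v : ℝ)) = ∑ v, (if v = a then θ v else 0) from
      sum_congr rfl fun v _ => by by_cases hv : v = a <;> simp [hv]]
    rw [Finset.sum_ite_eq' univ a]; simp
  have hMYeq : ∑ v, θ v * (NY v : ℝ) = ∑ v, θ v * (NC v : ℝ) + θ b := by
    rw [hY]; simp only [Pi.add_apply, Nat.cast_add, mul_add, sum_add_distrib]
    congr 1
    rw [show (∑ v, θ v * ((Pi.single b (1 : ℕ) : S → ℕ) v : ℝ)) = ∑ v, (if v = b then θ v else 0) from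
      sum_congr rfl fun v _ => by by_cases hv : v = b <;> simp [hv]]
    rw [Finset.sum_ite_eq' univ b]; simp
  have hσθz : 0 ≤ (1 - σ) * θ z := mul_nonneg (by linarith only [hσ1]) (by linarith only [(hθm z).1])
  have hσθz1 : (1 - σ) * θ z ≤ 1 := mul_le_one₀ (by linarith only [hσ0]) (by linarith only [(hθm z).1]) (hθm z).2
  have hΦe2 : Φ + e - 2 = c - 2 + (∑ v, θ v * (NX v : ℝ) + ∑ v, θ v * (NY v : ℝ)) + 2 * σ * ∑ v, μ0 v * θ v := by
    rw [hΦ, he, hsplit]; ring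
  have hL2 : 0 ≤ Φ + e - 2 := by rw [hΦe2]; linarith only [hMX.1, hMY.1, mul_nonneg hσ0 hθbar0, hc, hK2]
  have hΦpos : 0 < Φ := by rw [hΦ, hsplit]; linarith only [hMX.1, hMY.1, hσθz1, hc, hK2]
  have hΦle : Φ ≤ c + 2 * K + 2 := by
    rw [hΦ, hsplit]; have h1 := hMX.2; have h2 := hMY.2; rw [hsumXr] at h1; rw [hsumYr] at h2; linarith only [h1, h2, hσθz]
  -- §A the per-attempt values (AC10 + Z8)
  have hVle : ∀ j, V j ≤ Φ + (e - 2) + cx j + cy j - (Φ + e - 2) * g j + (Φ + e - 1) * ε j := by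
    intro j
    have hu0X := (hwXlaw j).1
    have hu1X := (hwXlaw j).2
    have hu0Y := (hwYlaw j).1
    have hu1Y := (hwYlaw j).2
    have hSX : ∀ α, wX j α ≠ 0 → NX = (NX - Pi.single α 1) + Pi.single α 1 := fun α hα => urnChain_survivor NX (hlegX j α hα)
    have hSY : ∀ β, wY j β ≠ 0 → NY = (NY - Pi.single β 1) + Pi.single β 1 := fun β hβ => urnChain_survivor NY (hlegY j β hβ)
    -- the gain term of AC10 is `g_j − 𝟙{z ∉ {a,b}}ε_j` (Z8)
    have hG : (wX j a - wY j a) - ∑ w, (if w ≠ a ∧ w ≠ b then max (wY j w - wX j w) 0 else 0) = g j - (if z ≠ a ∧ z ≠ b then ε j else 0) := by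
      have h1 : wX j a - wY j a = x j none + (x j (some a) - y j (some a)) := by rw [hlX, hlY, if_pos rfl, if_neg hab]; ring
      have h2 : ∑ w, (if w ≠ a ∧ w ≠ b then max (wY j w - wX j w) 0 else 0) = ∑ w, (if w ≠ a ∧ w ≠ b then max (y j (some w) - x j (some w)) 0 else (0 : ℝ)) :=
        sum_congr rfl fun w _ => by
          by_cases h : (w ≠ a ∧ w ≠ b)
          · rw [if_pos h, if_pos h, hlX, hlY, if_neg h.1, if_neg h.2, add_zero, add_zero]
          · rw [if_neg h, if_neg h]
      rw [h2, tagged_perStep_penalty hW hacc hK1 hNC hWab hPXoff hPXin hPXdiag hPXout hPXstay hPYoff hPYin hPYdiag hPYout hPYstay hz hx0 hxs hy0 hys j, h1, hg, hε]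
    -- the cost terms
    have hR : Φ + e - ∑ w, wX j w * θ w - ∑ w, wY j w * θ w = Φ + (e - 2) + cx j + cy j := by
      have e1 : ∑ w, wX j w * θ w = 1 - cx j := by
        rw [hcx, show (∑ w, wX j w * (1 - θ w)) = ∑ w, wX j w - ∑ w, wX j w * θ w by rw [← sum_sub_distrib]; exact sum_congr rfl fun w _ => by ring, hu1X]; ring
      have e2 : ∑ w, wY j w * θ w = 1 - cy j := by
        rw [hcy, show (∑ w, wY j w * (1 - θ w)) = ∑ w, wY j w - ∑ w, wY j w * θ w by rw [← sum_sub_distrib]; exact sum_congr rfl fun w _ => by ring, hu1Y]; ring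
      rw [e1, e2]; ring
    by_cases hzb : z = b
    · -- domination off `{a, b}`: AC10 with its free content `:= a`; no growth term
      have hdom : ∀ w, w ≠ a → w ≠ b → wY j w ≤ wX j w := by
        intro w hwa hwb
        rw [hlX, hlY, if_neg hwa, if_neg hwb, add_zero, add_zero]
        exact hdomZ j w (by rw [hzb]; exact hwb)
      have hbr := adjacent_perStep_bracket (z := a) (Φ := Φ) (e := e) (θ := θ) hΔ hab hX hY hu0X hu0Y hu1X hu1Y
        (MX := fun α => NX - Pi.single α 1) (MY := fun β => NY - Pi.single β 1) hSX hSY hdom (fun w => (hθm w).1) (fun w => (hθm w).2)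
      have hlast : max (wY j a - wX j a) 0 = 0 := by
        apply max_eq_right
        rw [hlX, hlY, if_pos rfl, if_neg hab, add_zero]
        have h1 : y j (some a) ≤ x j (some a) := hdomZ j a (fun h => hab (h.trans hzb))
        linarith only [(hxlaw j).1 none, h1]
      have hnz : ¬ (z ≠ a ∧ z ≠ b) := fun h => h.2 hzb
      rw [← hV, hR, hG, hlast, if_neg hnz, sub_zero, add_zero] at hbr
      have : 0 ≤ (Φ + e - 1) * ε j := mul_nonneg (by linarith only [hL2]) (hε0 j)
      linarith only [hbr, this]
    · -- domination off `{z, b}`: AC10 with its free content `:= z`; growth term `≤ ε_j`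
      have hdom : ∀ w, w ≠ z → w ≠ b → wY j w ≤ wX j w := by
        intro w hwz hwb
        rw [hlX, hlY, if_neg hwb, add_zero]
        have h1 := hdomZ j w hwz
        by_cases hwa : w = a
        · rw [if_pos hwa]; linarith only [(hxlaw j).1 none, h1]
        · rw [if_neg hwa, add_zero]; exact h1
      have hbr := adjacent_perStep_bracket (z := z) (Φ := Φ) (e := e) (θ := θ) hΔ hab hX hY hu0X hu0Y hu1X hu1Y
        (MX := fun α => NX - Pi.single α 1) (MY := fun β => NY - Pi.single β 1) hSX hSY hdom (fun w => (hθm w).1) (fun w => (hθm w).2)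
      have hlast : max (wY j z - wX j z) 0 ≤ ε j := by
        rw [hε, hlX, hlY, if_neg hzb, add_zero]
        by_cases hza : z = a
        · rw [if_pos hza]
          exact max_le_max (by linarith only [(hxlaw j).1 none]) le_rfl
        · rw [if_neg hza, add_zero]
      rw [← hV, hR, hG] at hbr
      have hind : (if z ≠ a ∧ z ≠ b then ε j else 0) ≤ ε j := by split_ifs; exacts [le_rfl, hε0 j]
      have h1 := mul_le_mul_of_nonneg_left hind hL2
      linarith only [h1, hlast, hbr]
  -- §B the resolvents on `Option S` and the truncated discounted sums (AC9)
  obtain ⟨ν, hν⟩ : ∃ ν : Option S → ℝ, ∀ t, ν t = if t = some z then 1 else 0 := ⟨_, fun _ => rfl⟩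
  have hν0 : ∀ t, 0 ≤ ν t := fun t => by rw [hν]; split_ifs <;> norm_num
  have hν1 : ∑ t, ν t = 1 := by simp_rw [hν]; rw [Finset.sum_ite_eq' univ (some z)]; simp
  have hx0' : ∀ t, x 0 t = ν t := fun t => by rw [hx0, hν]
  have hy0' : ∀ t, y 0 t = ν t := fun t => by rw [hy0, hν]
  obtain ⟨uX, huX⟩ : ∃ u : Option S → ℝ, ∀ t, u t = (1 - σ) * (if t = some z then 1 else 0) + σ * xt t := ⟨_, fun _ => rfl⟩
  obtain ⟨uY, huY⟩ : ∃ u : Option S → ℝ, ∀ t, u t = (1 - σ) * (if t = some z then 1 else 0) + σ * yt t := ⟨_, fun _ => rfl⟩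
  have huXeq : ∀ t, uX t = (1 - σ) * ν t + σ * ∑ t', uX t' * PX t' t := fun t => by
    rw [hν]; exact resolvent_of_tail (P := PX) hxt huX t
  have huYeq : ∀ t, uY t = (1 - σ) * ν t + σ * ∑ t', uY t' * PY t' t := fun t => by
    rw [hν]; exact resolvent_of_tail (P := PY) hyt huY t
  -- costs
  obtain ⟨fa, hfa⟩ : ∃ f : Option S → ℝ, ∀ t, f t = Option.elim t (1 - θ a) (fun v => 1 - θ v) := ⟨_, fun _ => rfl⟩
  obtain ⟨fb, hfb⟩ : ∃ f : Option S → ℝ, ∀ t, f t = Option.elim t (1 - θ b) (fun v => 1 - θ v) := ⟨_, fun _ => rfl⟩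
  have hfa0 : ∀ t, 0 ≤ fa t := fun t => by
    rw [hfa]; rcases t with _ | v
    · simp only [Option.elim]; linarith only [(hθm a).2]
    · simp only [Option.elim]; linarith only [(hθm v).2]
  have hfa1 : ∀ t, fa t ≤ 1 := fun t => by
    rw [hfa]; rcases t with _ | v
    · simp only [Option.elim]; linarith only [(hθm a).1]
    · simp only [Option.elim]; linarith only [(hθm v).1]
  have hfb0 : ∀ t, 0 ≤ fb t := fun t => by
    rw [hfb]; rcases t with _ | v
    · simp only [Option.elim]; linarith only [(hθm b).2]
    · simp only [Option.elim]; linarith only [(hθm v).2]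
  have hfb1 : ∀ t, fb t ≤ 1 := fun t => by
    rw [hfb]; rcases t with _ | v
    · simp only [Option.elim]; linarith only [(hθm b).1]
    · simp only [Option.elim]; linarith only [(hθm v).1]
  have hcxf : ∀ j, cx j = ∑ t, x j t * fa t := fun j => by
    rw [hcx, lump_cost (θ := θ) (hlX j), tagged_sum_option]; simp only [hfa, Option.elim]; ring
  have hcyf : ∀ j, cy j = ∑ t, y j t * fb t := fun j => by
    rw [hcy, lump_cost (θ := θ) (hlY j), tagged_sum_option]; simp only [hfb, Option.elim]; ring
  have hUfa : ∑ t, uX t * fa t = (1 - σ) * (1 - θ z) + σ * (∑ v, xt (some v) * (1 - θ v) + xt none * (1 - θ a)) := by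
    rw [tagged_sum_option]
    have h1 : uX none * fa none = σ * (xt none * (1 - θ a)) := by
      rw [huX, hfa, if_neg (by simp)]; simp only [Option.elim]; ring
    have h2 : ∀ v, uX (some v) * fa (some v) = (1 - σ) * ((if v = z then 1 else 0) * (1 - θ v)) + σ * (xt (some v) * (1 - θ v)) := by
      intro v; rw [huX, hfa]; simp only [Option.elim, Option.some.injEq]; ring
    rw [h1, sum_congr rfl fun v _ => h2 v, sum_add_distrib, ← mul_sum, ← mul_sum]
    have h3 : ∑ v, (if v = z then (1 : ℝ) else 0) * (1 - θ v) = 1 - θ z := by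
      rw [show (∑ v, (if v = z then (1 : ℝ) else 0) * (1 - θ v)) = ∑ v, (if v = z then (1 - θ v) else 0) from
        sum_congr rfl fun v _ => by split_ifs <;> simp, Finset.sum_ite_eq' univ z]; simp
    rw [h3]; ring
  have hUfb : ∑ t, uY t * fb t = (1 - σ) * (1 - θ z) + σ * (∑ v, yt (some v) * (1 - θ v) + yt none * (1 - θ b)) := by
    rw [tagged_sum_option]
    have h1 : uY none * fb none = σ * (yt none * (1 - θ b)) := by
      rw [huY, hfb, if_neg (by simp)]; simp only [Option.elim]; ring
    have h2 : ∀ v, uY (some v) * fb (some v) = (1 - σ) * ((if v = z then 1 else 0) * (1 - θ v)) + σ * (yt (some v) * (1 - θ v)) := by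
      intro v; rw [huY, hfb]; simp only [Option.elim, Option.some.injEq]; ring
    rw [h1, sum_congr rfl fun v _ => h2 v, sum_add_distrib, ← mul_sum, ← mul_sum]
    have h3 : ∑ v, (if v = z then (1 : ℝ) else 0) * (1 - θ v) = 1 - θ z := by
      rw [show (∑ v, (if v = z then (1 : ℝ) else 0) * (1 - θ v)) = ∑ v, (if v = z then (1 - θ v) else 0) from
        sum_congr rfl fun v _ => by split_ifs <;> simp, Finset.sum_ite_eq' univ z]; simp
    rw [h3]; ring
  have hcxS : ∀ n, ∑ j ∈ range n, σ ^ j * (1 - σ) * cx j ≤ (1 - σ) * (1 - θ z) + σ * (∑ v, xt (some v) * (1 - θ v) + xt none * (1 - θ a)) := by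
    intro n
    rw [← hUfa, sum_congr rfl fun j _ => by rw [hcxf]]
    exact (resolvent_partial_expect hPX0 hPX1 hσ0 hσ1 hν0 hν1 huXeq hx0' hxs hfa0 hfa1 n).2
  have hcyS : ∀ n, ∑ j ∈ range n, σ ^ j * (1 - σ) * cy j ≤ (1 - σ) * (1 - θ z) + σ * (∑ v, yt (some v) * (1 - θ v) + yt none * (1 - θ b)) := by
    intro n
    rw [← hUfb, sum_congr rfl fun j _ => by rw [hcyf]]
    exact (resolvent_partial_expect hPY0 hPY1 hσ0 hσ1 hν0 hν1 huYeq hy0' hys hfb0 hfb1 n).2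
  -- gains
  have hgS : ∀ n, σ * (xt none + (xt (some a) - yt (some a))) - σ ^ n ≤ ∑ j ∈ range n, σ ^ j * (1 - σ) * g j := by
    intro n
    obtain ⟨f, hf⟩ : ∃ f : Option S → ℝ, ∀ t, f t = if t = none ∨ t = some a then 1 else 0 := ⟨_, fun _ => rfl⟩
    have hf0 : ∀ t, 0 ≤ f t := fun t => by rw [hf]; split_ifs <;> norm_num
    have hf1 : ∀ t, f t ≤ 1 := fun t => by rw [hf]; split_ifs <;> norm_num
    have hxf : ∀ j, ∑ t, x j t * f t = x j none + x j (some a) := by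
      intro j
      rw [tagged_sum_option, hf]
      simp only [true_or, if_true, mul_one]
      congr 1
      rw [show (∑ v, x j (some v) * f (some v)) = ∑ v, (if v = a then x j (some v) else 0) from
        sum_congr rfl fun v _ => by rw [hf]; by_cases hv : v = a <;> simp [hv]]
      rw [Finset.sum_ite_eq' univ a]; simp
    have hUf : ∑ t, uX t * f t = σ * xt none + ((1 - σ) * (if a = z then 1 else 0) + σ * xt (some a)) := by
      rw [tagged_sum_option, hf]
      simp only [true_or, if_true, mul_one]
      rw [show (∑ v, uX (some v) * f (some v)) = ∑ v, (if v = a then uX (some v) else 0) from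
        sum_congr rfl fun v _ => by rw [hf]; by_cases hv : v = a <;> simp [hv]]
      rw [Finset.sum_ite_eq' univ a, huX, huX]; simp
    have h1 := (resolvent_partial_expect hPX0 hPX1 hσ0 hσ1 hν0 hν1 huXeq hx0' hxs hf0 hf1 n).1
    have h2 := resolvent_partial_le hPY0 hPY1 hσ0 hσ1 hν0 hν1 huYeq hy0' hys n (some a)
    have hUa : uY (some a) = (1 - σ) * (if a = z then 1 else 0) + σ * yt (some a) := by rw [huY]; simp
    have hsplitg : ∑ j ∈ range n, σ ^ j * (1 - σ) * g j
        = ∑ j ∈ range n, σ ^ j * (1 - σ) * ∑ t, x j t * f t - ∑ j ∈ range n, σ ^ j * (1 - σ) * y j (some a) := by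
      rw [← sum_sub_distrib]; exact sum_congr rfl fun j _ => by rw [hxf, hg]; ring
    rw [hsplitg]; rw [hUf] at h1; rw [hUa] at h2; linarith only [h1, h2]
  -- deficits: `Σ_{j<n}σʲ(1−σ)ε_j = σ·D_{n−1}`
  have hεS : ∀ n, ∑ j ∈ range n, σ ^ j * (1 - σ) * ε j = σ * ∑ i ∈ range (n - 1), (1 - σ) * σ ^ i * max 0 (y (i + 1) (some z) - x (i + 1) (some z)) := by
    intro n
    cases n with
    | zero => simp
    | succ m =>
        rw [Nat.add_sub_cancel, sum_range_succ', pow_zero]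
        have hε00 : ε 0 = 0 := by rw [hε, hx0, hy0]; simp
        rw [hε00, mul_zero, add_zero, mul_sum]
        exact sum_congr rfl fun i _ => by rw [hε, max_comm, pow_succ]; ring
  -- §C the certificate (AC3 + AC13 + W26 → AC17)
  have hdomA : yt (some a) ≤ xt (some a) :=
    tagged_hub_domination hW hacc hK1 hNC hWab hPXoff hPXin hPXdiag hPXout hPXstay hPYoff hPYin hPYdiag hPYout hPYstay hσ0 hσ1 hz hxt hyt a
  have hxt0 : 0 ≤ xt none := geomResolvent_nonneg hPX0 hPX1 hσ0 hσ1 (ν := fun t => PX (some z) t) (fun t => hPX0 _ _) hxt none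
  have hgt : 0 ≤ xt none + (xt (some a) - yt (some a)) := by linarith only [hdomA, hxt0]
  have hK4 : (2 : ℝ) ^ 2 ≤ (K : ℝ) ^ 2 := pow_le_pow_left₀ (by norm_num) hK2 2
  have hK21 : (0 : ℝ) < (K : ℝ) ^ 2 - 1 := by linarith only [hK4]
  have hκ0 : 0 ≤ (K : ℝ) / ((K : ℝ) ^ 2 - 1) := div_nonneg (by linarith only [hK2]) hK21.le
  have hκ : (K : ℝ) / ((K : ℝ) ^ 2 - 1) * (2 + 1) ≤ 2 := by
    rw [div_mul_eq_mul_div, div_le_iff₀ hK21]; nlinarith only [hK2]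
  have hL0 : 0 ≤ 2 * (K : ℝ) + (∑ v, θ v * (NC v : ℝ) + θ a) + (∑ v, θ v * (NC v : ℝ) + θ b) := by
    rw [← hMXeq, ← hMYeq]; linarith only [hMX.1, hMY.1, hK2]
  have hLle : 2 * (K : ℝ) + (∑ v, θ v * (NC v : ℝ) + θ a) + (∑ v, θ v * (NC v : ℝ) + θ b) + 2 ≤ Φ + e - 2 := by
    rw [hΦe2, hMXeq, hMYeq]; linarith only [mul_nonneg hσ0 hθbar0, hc]
  have he2 : e - 2 = -2 * (1 - σ) * (1 - θ z) - 2 * σ * (1 - ∑ v, μ0 v * θ v) := by rw [he]; ring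
  have hθbar : 1 - ∑ v, μ0 v * θ v = p * ∑ v, μ0 v * (W v * θ v) := by
    have h1 : ∑ v, μ0 v * θ v = ∑ v, μ0 v - ∑ v, μ0 v * (p * (W v * θ v)) := by
      rw [← sum_sub_distrib]; exact sum_congr rfl fun v _ => by rw [← persist_one_sub_theta hW hp0 hθ v]; ring
    rw [h1, hμ1, mul_sum]; have : ∑ v, μ0 v * (p * (W v * θ v)) = ∑ v, p * (μ0 v * (W v * θ v)) := sum_congr rfl fun v _ => by ring
    rw [this]; ring
  have hrtΦ : rt * Φ ≤ 2 * σ * (1 - ∑ v, μ0 v * θ v) := by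
    rw [hθbar]; exact le_trans (mul_le_mul_of_nonneg_left hΦle hrt0) hrt
  have hcertS : ∀ n, (e - 2) + ((1 - σ) * (1 - θ z) + σ * (∑ v, xt (some v) * (1 - θ v) + xt none * (1 - θ a)))
      + ((1 - σ) * (1 - θ z) + σ * (∑ v, yt (some v) * (1 - θ v) + yt none * (1 - θ b)))
      + (Φ + e - 1) * ∑ j ∈ range n, σ ^ j * (1 - σ) * ε j + rt * Φ ≤ (Φ + e - 2) * (σ * (xt none + (xt (some a) - yt (some a)))) := by
    intro n
    rw [hεS n]
    have hWc := tagged_perAttempt_certificate_everyEdge_all hW hp0 hp hθ hacc hK hNC hWab hPXoff hPXin hPXdiag hPXout hPXstay hPYoff hPYin hPYdiag hPYout hPYstay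
      hz hx0 hxs hy0 hys (M := ∑ v, θ v * (NC v : ℝ) + θ a) rfl (L := 2 * K + (∑ v, θ v * (NC v : ℝ) + θ a) + (∑ v, θ v * (NC v : ℝ) + θ b)) rfl
      hσ0 hσ1 hxt hyt hxsr hysr (n - 1)
    have hSc := tagged_deficit_le_star_everyEdge hW hacc hK hNC hWab hPXoff hPXin hPXdiag hPXout hPXstay hPYoff hPYin hPYdiag hPYout hPYstay
      hz hx0 hxs hy0 hys hσ0 hσ1 hxt (n - 1)
    have hSig : ∑ i ∈ range (n - 1), (1 - σ) * σ ^ i * max 0 (y (i + 1) (some z) - x (i + 1) (some z))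
        ≤ (K : ℝ) / ((K : ℝ) ^ 2 - 1) * (xt none + (xt (some a) - yt (some a))) :=
      hSc.trans (mul_le_mul_of_nonneg_left (by linarith only [hdomA]) hκ0)
    exact perEdge_certificate (m := 2) hσ0 hWc hSig hκ (by norm_num) hgt le_rfl hL0 hLle he2 hrtΦ
  -- §D AC16 concludes
  exact perAttempt_mean_of_certificate hΦpos hL2 hVle hcxS hcyS hgS hσ0 hσ1.le hcertS n

end PerAttemptMean

end Summit.Ventures.LatticeQCDFlow.Scaling
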